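import Summits.HubbardSuperconductivity.HubbardSuperconductivity.Theorems.AnisotropyChordInsertionEntropyOneState
import Summits.HubbardSuperconductivity.HubbardSuperconductivity.Theorems.AnisotropyChordInsertionEntropyJastrowResampling
import Summits.HubbardSuperconductivity.HubbardSuperconductivity.Theorems.AnisotropyChordInsertionEntropyJastrow
import Summits.HubbardSuperconductivity.HubbardSuperconductivity.Theorems.AnisotropyChordInsertionEntropyLatticeSum
import Mathlib.Analysis.SpecialFunctions.Log.Basic

/-!
# Route `AnisotropyChord` / H0 rotor rung: Part S — the QUANTUM-TRANSFER INTERFACE (model-independent;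
# port, verbatim up to namespace, of theory seat `hubbard-h0-rotor-theory-1` file PartS_Transfer.lean, memo ROTOR-THEORY-9 §136)

For ANY non-negative amplitude `ψ` on an `N`-particle sector of hard-core bosons on a finite vertex set
`V` (in particular the Perron ground state of a stoquastic Hamiltonian), the condensate density is bounded
below by the PAIR-MASS-AVERAGED teleportation entropy:

  `n₀/|V| ≥ ρ(1−ρ) · exp(−K/2)` whenever `Σ_{x≠y} a_{xy} KL(ν_x^{(y)} ‖ ν_y^{(x)}) ≤ K · N(|V|−N)`

(`condensateDensity_ge_of_avgTeleEntropy`; the landed E-FLOOR′ needed `sup_{x≠y} KL ≤ K`).  Since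
`Σ_{x≠y} a_{xy} KL_{xy} = −N(|V|−N) · T(ψ)` with the MEAN TELEPORTATION LOG-RATIO
`T(ψ) = E_{ψ²} (1/(N(|V|−N))) Σ_{u occ, v emp} log(ψ(σ^{u→v})²/ψ(σ)²)` (`meanTeleLog`), the whole
model-independent content of «⇒ BEC» is the single inequality `T(ψ_L) ≥ −K` uniformly in `L`
(«deconfinement of the teleported particle–hole pair», Reatto's half-charge criterion in entropy form).
H0 in this currency: `TeleDeconfined` for ground states with uniform stiffness + compressibility.
-/

set_option linter.dupNamespace false

noncomputable section

open Finset
open Literature.Probability.LatticeModels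

namespace Summit.HubbardSuperconductivity.HubbardSuperconductivity.Theorems.AnisotropyChord.InsertionEntropy

section TeleTransfer

variable {V : Type} [Fintype V] [DecidableEq V]

/-- The condensate density is non-negative. [folklore] -/
theorem condensateDensity_nonneg (a : (V → Fin 2) → ℝ) : 0 ≤ condensateDensity a := by
  unfold condensateDensity lowerNormSq
  positivity

/-- `Σ_{y ≠ x} f y = Σ_y (if x = y then 0 else f y)`. -/
theorem sum_erase_eq_sum_ite (x : V) (f : V → ℝ) :
    ∑ y ∈ univ.erase x, f y = ∑ y, (if x = y then 0 else f y) := by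
  rw [Finset.sum_erase_eq_sub (Finset.mem_univ x)]
  have h : ∑ y, (if x = y then (0:ℝ) else f y) = ∑ y, f y - ∑ y, (if x = y then f y else 0) := by
    rw [← Finset.sum_sub_distrib]
    exact Finset.sum_congr rfl fun y _ => by split_ifs <;> ring
  rw [h, Finset.sum_ite_eq univ x f, if_pos (Finset.mem_univ x)]

/-- **AVERAGED ONE-STATE ENTROPY FLOOR.**  For a non-negative `N`-sector amplitude with `Σ ψ² = 1`,
symmetric pair masses and teleportation-support symmetry, the PAIR-MASS-WEIGHTED MEAN of the
teleportation entropies controls the condensate: `Σ_{x ≠ y} a_{xy} KL(ν_x^{(y)} ‖ ν_y^{(x)}) ≤ K·N(|V|−N)`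
implies `n₀/|V| ≥ (N/|V|)(1 − N/|V|) e^{−K/2}`.  (Jensen over pairs on top of the per-pair Bhattacharyya
bound `pairCorr_ge`; the sup-form E-FLOOR′ is the special case `KL_{xy} ≤ K ∀ x ≠ y`.) -/
theorem condensateDensity_ge_of_avgTeleEntropy [Nonempty V] (a : (V → Fin 2) → ℝ) (N K : ℝ)
    (hN : ∀ σ, 0 ≤ a σ) (h1 : ∑ σ, a σ ^ 2 = 1)
    (hsect : ∀ σ, a σ ≠ 0 → ((univ.filter fun z => σ z = 0).card : ℝ) = N)
    (hsym : ∀ x y, pairMass a x y = pairMass a y x)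
    (hac : ∀ x y τ, x ≠ y → 0 < teleLaw a x y τ → 0 < teleLaw a y x τ)
    (hK : ∑ x, ∑ y ∈ univ.erase x, pairMass a x y * klDiv (teleLaw a x y) (teleLaw a y x)
            ≤ K * (N * ((Fintype.card V : ℝ) - N))) :
    (N / Fintype.card V) * (1 - N / Fintype.card V) * Real.exp (-K / 2) ≤ condensateDensity a := by
  have hcard : (0:ℝ) < (Fintype.card V : ℝ) := by exact_mod_cast Fintype.card_pos
  set k : ℝ := N * ((Fintype.card V : ℝ) - N) with hk
  have hmass : ∑ x, ∑ y ∈ univ.erase x, pairMass a x y = k := sum_pairMass_eq a N h1 hsect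
  have hL : (N / Fintype.card V) * (1 - N / Fintype.card V) * Real.exp (-K / 2)
      = k * Real.exp (-K / 2) / (Fintype.card V : ℝ) ^ 2 := by
    rw [hk]; field_simp
  have hcd : condensateDensity a * (Fintype.card V : ℝ) ^ 2 = lowerNormSq a := by
    unfold condensateDensity; field_simp
  rw [hL, div_le_iff₀ (by positivity), hcd, lowerNormSq_eq_sum_pairCorr]
  have hcorr_nonneg : 0 ≤ ∑ x, ∑ y, pairCorr a x y :=
    Finset.sum_nonneg fun x _ => Finset.sum_nonneg fun y _ => pairCorr_nonneg a hN x y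
  rcases le_or_gt k 0 with hk0 | hkpos
  · calc k * Real.exp (-K / 2) ≤ 0 := by nlinarith [Real.exp_pos (-K / 2)]
      _ ≤ ∑ x, ∑ y, pairCorr a x y := hcorr_nonneg
  · -- Jensen over ordered pairs `(x, y)`, weights `w = a_{xy}` off the diagonal, exponents `−KL_{xy}/2`
    let w : V × V → ℝ := fun p => if p.1 = p.2 then 0 else pairMass a p.1 p.2
    let z : V × V → ℝ := fun p => -(klDiv (teleLaw a p.1 p.2) (teleLaw a p.2 p.1)) / 2
    have hw : ∀ p, 0 ≤ w p := fun p => by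
      simp only [w]; split_ifs
      · exact le_rfl
      · exact pairMass_nonneg a _ _
    have hwsum : ∑ p, w p = k := by
      rw [Fintype.sum_prod_type, ← hmass]
      exact Finset.sum_congr rfl fun x _ => (sum_erase_eq_sum_ite x (fun y => pairMass a x y)).symm
    have hwz : -K / 2 * k ≤ ∑ p, w p * z p := by
      have hx : ∑ p, w p * z p
          = -(∑ x, ∑ y ∈ univ.erase x, pairMass a x y * klDiv (teleLaw a x y) (teleLaw a y x)) / 2 := by
        rw [Fintype.sum_prod_type]
        have hin : ∀ x, ∑ y, w (x, y) * z (x, y)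
            = -(∑ y ∈ univ.erase x, pairMass a x y * klDiv (teleLaw a x y) (teleLaw a y x)) / 2 := by
          intro x
          have hwz' : ∀ y, w (x, y) * z (x, y)
              = if x = y then 0 else pairMass a x y * (-(klDiv (teleLaw a x y) (teleLaw a y x)) / 2) := by
            intro y; simp only [w, z]; split_ifs <;> ring
          rw [Finset.sum_congr rfl fun y _ => hwz' y,
            ← sum_erase_eq_sum_ite x (fun y => pairMass a x y * (-(klDiv (teleLaw a x y) (teleLaw a y x)) / 2))]
          have h2 : ∑ y ∈ univ.erase x, pairMass a x y * (-(klDiv (teleLaw a x y) (teleLaw a y x)) / 2)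
              = ∑ y ∈ univ.erase x, (-(1:ℝ) / 2) * (pairMass a x y * klDiv (teleLaw a x y) (teleLaw a y x)) :=
            Finset.sum_congr rfl fun y _ => by ring
          rw [h2, ← Finset.mul_sum]
          ring
        rw [Finset.sum_congr rfl fun x _ => hin x, ← Finset.sum_div, ← Finset.sum_neg_distrib]
      rw [hx]
      linarith
    have hJ := mass_mul_exp_avg_le w z k hkpos hw hwsum
    have havg : -K / 2 ≤ (∑ p, w p * z p) / k := by
      rw [le_div_iff₀ hkpos]; exact hwz
    have hterm : ∑ p, w p * Real.exp (z p) ≤ ∑ x, ∑ y, pairCorr a x y := by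
      rw [Fintype.sum_prod_type]
      refine Finset.sum_le_sum fun x _ => Finset.sum_le_sum fun y _ => ?_
      simp only [w, z]
      split_ifs with hxy
      · rw [zero_mul]; exact pairCorr_nonneg a hN x y
      · have := pairCorr_ge a hN x y (klDiv (teleLaw a x y) (teleLaw a y x)) (hsym x y)
          (fun τ => hac x y τ hxy) le_rfl
        simpa [neg_div] using this
    calc k * Real.exp (-K / 2) ≤ k * Real.exp ((∑ p, w p * z p) / k) :=
          mul_le_mul_of_nonneg_left (Real.exp_le_exp.mpr havg) hkpos.le
      _ ≤ ∑ p, w p * Real.exp (z p) := hJ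
      _ ≤ ∑ x, ∑ y, pairCorr a x y := hterm


omit [Fintype V] in
/-- The move `τ ↦ update τ y 0` equals `(update τ x 0) ∘ swap x y` on templates with `τ x = τ y = 1`. -/
theorem update_eq_update_comp_swap (τ : V → Fin 2) (x y : V) (hxy : x ≠ y) (hx : τ x = 1) (hy : τ y = 1) :
    Function.update τ y 0 = Function.update τ x 0 ∘ Equiv.swap x y := by
  funext z
  simp only [Function.comp]
  by_cases hzx : z = x
  · subst hzx
    rw [Function.update_of_ne hxy, Equiv.swap_apply_left, Function.update_of_ne (Ne.symm hxy), hx, hy]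
  · by_cases hzy : z = y
    · subst hzy
      rw [Function.update_self, Equiv.swap_apply_right, Function.update_self]
    · rw [Function.update_of_ne hzy, Equiv.swap_apply_of_ne_of_ne hzx hzy, Function.update_of_ne hzx]

/-- **Pair mass × teleportation entropy in particle coordinates:**
`a_{xy} · KL(ν_x^{(y)} ‖ ν_y^{(x)}) = −Σ_{σ : x occ, y emp} ψ(σ)² log(ψ(σ^{x→y})²/ψ(σ)²)` for a non-negative
amplitude whose support is closed under the move `x → y` and with `a_{xy} = a_{yx}`. -/
theorem pairMass_mul_klDiv_eq (a : (V → Fin 2) → ℝ) (hN : ∀ σ, 0 ≤ a σ) (x y : V) (hxy : x ≠ y)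
    (hsym : pairMass a x y = pairMass a y x)
    (hmove : ∀ σ : V → Fin 2, σ x = 0 → σ y = 1 → 0 < a σ → 0 < a (σ ∘ Equiv.swap x y))
    (hmove' : ∀ σ : V → Fin 2, σ y = 0 → σ x = 1 → 0 < a σ → 0 < a (σ ∘ Equiv.swap y x)) :
    pairMass a x y * klDiv (teleLaw a x y) (teleLaw a y x)
      = -∑ σ : V → Fin 2, (if σ x = 0 ∧ σ y = 1 then
          a σ ^ 2 * Real.log (a (σ ∘ Equiv.swap x y) ^ 2 / a σ ^ 2) else 0) := by
  -- the particle-coordinate sum, reindexed to templates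
  have hre : ∑ σ : V → Fin 2, (if σ x = 0 ∧ σ y = 1 then
        a σ ^ 2 * Real.log (a (σ ∘ Equiv.swap x y) ^ 2 / a σ ^ 2) else 0)
      = ∑ τ : V → Fin 2, (if τ x = 1 ∧ τ y = 1 then
        a (Function.update τ x 0) ^ 2 *
          Real.log (a (Function.update τ y 0) ^ 2 / a (Function.update τ x 0) ^ 2) else 0) := by
    have h := sum_update_reindex x (fun σ => if σ y = 1 then
        a σ ^ 2 * Real.log (a (σ ∘ Equiv.swap x y) ^ 2 / a σ ^ 2) else 0)
    have hL : ∀ τ : V → Fin 2,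
        (if τ x = 1 then (if (Function.update τ x 0) y = 1 then
          a (Function.update τ x 0) ^ 2 *
            Real.log (a (Function.update τ x 0 ∘ Equiv.swap x y) ^ 2 / a (Function.update τ x 0) ^ 2)
          else 0) else 0)
        = (if τ x = 1 ∧ τ y = 1 then a (Function.update τ x 0) ^ 2 *
            Real.log (a (Function.update τ y 0) ^ 2 / a (Function.update τ x 0) ^ 2) else (0:ℝ)) := by
      intro τ
      rw [Function.update_of_ne (Ne.symm hxy)]
      by_cases hx : τ x = 1
      · by_cases hy : τ y = 1
        · rw [if_pos hx, if_pos hy, if_pos ⟨hx, hy⟩, ← update_eq_update_comp_swap τ x y hxy hx hy]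
        · rw [if_pos hx, if_neg hy, if_neg (fun h => hy h.2)]
      · rw [if_neg hx, if_neg (fun h => hx h.1)]
    have hR : ∀ σ : V → Fin 2,
        (if σ x = 0 then (if σ y = 1 then
          a σ ^ 2 * Real.log (a (σ ∘ Equiv.swap x y) ^ 2 / a σ ^ 2) else 0) else 0)
        = (if σ x = 0 ∧ σ y = 1 then
          a σ ^ 2 * Real.log (a (σ ∘ Equiv.swap x y) ^ 2 / a σ ^ 2) else (0:ℝ)) := by
      intro σ
      by_cases hx : σ x = 0
      · by_cases hy : σ y = 1
        · rw [if_pos hx, if_pos hy, if_pos ⟨hx, hy⟩]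
        · rw [if_pos hx, if_neg hy, if_neg (fun h => hy h.2)]
      · rw [if_neg hx, if_neg (fun h => hx h.1)]
    rw [Finset.sum_congr rfl fun τ _ => hL τ, Finset.sum_congr rfl fun σ _ => hR σ] at h
    exact h.symm
  rw [hre]
  rcases eq_or_lt_of_le (pairMass_nonneg a x y) with h0 | hpos
  · -- zero pair mass: every template amplitude vanishes
    rw [← h0, zero_mul]
    have hz : ∀ τ : V → Fin 2, τ x = 1 ∧ τ y = 1 → a (Function.update τ x 0) ^ 2 = 0 := by
      intro τ hτ
      have hle : a (Function.update τ x 0) ^ 2 ≤ pairMass a x y := by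
        unfold pairMass
        have h := Finset.single_le_sum (s := Finset.univ)
          (f := fun τ' : V → Fin 2 => if τ' x = 1 ∧ τ' y = 1 then a (Function.update τ' x 0) ^ 2 else 0)
          (fun τ' _ => by
            show (0:ℝ) ≤ (if τ' x = 1 ∧ τ' y = 1 then a (Function.update τ' x 0) ^ 2 else 0)
            split_ifs
            · exact sq_nonneg _
            · exact le_rfl) (Finset.mem_univ τ)
        rw [if_pos hτ] at h
        exact h
      rw [← h0] at hle
      exact le_antisymm hle (sq_nonneg _)
    rw [eq_comm, neg_eq_zero]
    refine Finset.sum_eq_zero fun τ _ => ?_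
    split_ifs with hτ
    · rw [hz τ hτ, zero_mul]
    · rfl
  · have hsupp1 : ∀ τ : V → Fin 2, τ x = 1 → τ y = 1 →
        0 < a (Function.update τ x 0) → 0 < a (Function.update τ y 0) := by
      intro τ hx hy hpx
      rw [update_eq_update_comp_swap τ x y hxy hx hy]
      refine hmove _ ?_ ?_ hpx
      · rw [Function.update_self]
      · rw [Function.update_of_ne (Ne.symm hxy)]; exact hy
    have hsupp : ∀ τ : V → Fin 2, τ x = 1 → τ y = 1 →
        (0 < a (Function.update τ x 0) ↔ 0 < a (Function.update τ y 0)) := by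
      intro τ hx hy
      refine ⟨hsupp1 τ hx hy, fun hpy => ?_⟩
      rw [update_eq_update_comp_swap τ y x (Ne.symm hxy) hy hx]
      refine hmove' _ ?_ ?_ hpy
      · rw [Function.update_self]
      · rw [Function.update_of_ne hxy]; exact hx
    rw [klDiv_teleLaw_eq_of_support a hN x y hsupp hsym.symm, Finset.mul_sum, ← Finset.sum_neg_distrib]
    refine Finset.sum_congr rfl fun τ _ => ?_
    by_cases hτ : τ x = 1 ∧ τ y = 1
    · have ht : teleLaw a x y τ = a (Function.update τ x 0) ^ 2 / pairMass a x y := by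
        unfold teleLaw; rw [if_pos hτ]
      rw [ht, if_pos hτ]
      rcases eq_or_lt_of_le (hN (Function.update τ x 0)) with hz | hpx
      · rw [← hz]; simp
      · have hpy : 0 < a (Function.update τ y 0) := hsupp1 τ hτ.1 hτ.2 hpx
        rw [Real.log_div (pow_pos hpy 2).ne' (pow_pos hpx 2).ne', Real.log_pow, Real.log_pow]
        field_simp
        push_cast
        ring
    · have ht : teleLaw a x y τ = 0 := by unfold teleLaw; rw [if_neg hτ]
      rw [ht, if_neg hτ, zero_mul, mul_zero, neg_zero]

/-- Unnormalised form of `meanTeleLog`: `Σ_x Σ_{y ≠ x} a_{xy} KL_{xy} = −Σ_σ ψ(σ)² Σ_{u occ, v emp} log(ψ(σ^{u→v})²/ψ(σ)²)`. -/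
theorem sum_pairMass_mul_klDiv_eq (a : (V → Fin 2) → ℝ) (hN : ∀ σ, 0 ≤ a σ)
    (hsym : ∀ x y, pairMass a x y = pairMass a y x)
    (hmove : ∀ σ : V → Fin 2, ∀ u v : V, u ≠ v → σ u = 0 → σ v = 1 → 0 < a σ → 0 < a (σ ∘ Equiv.swap u v)) :
    ∑ x, ∑ y ∈ univ.erase x, pairMass a x y * klDiv (teleLaw a x y) (teleLaw a y x)
      = -∑ σ : V → Fin 2, a σ ^ 2 * ∑ u, ∑ v,
          (if σ u = 0 ∧ σ v = 1 then Real.log (a (σ ∘ Equiv.swap u v) ^ 2 / a σ ^ 2) else 0) := by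
  have hin : ∀ x, ∑ y ∈ univ.erase x, pairMass a x y * klDiv (teleLaw a x y) (teleLaw a y x)
      = ∑ y, -∑ σ : V → Fin 2, (if σ x = 0 ∧ σ y = 1 then
          a σ ^ 2 * Real.log (a (σ ∘ Equiv.swap x y) ^ 2 / a σ ^ 2) else 0) := by
    intro x
    rw [sum_erase_eq_sum_ite x]
    refine Finset.sum_congr rfl fun y _ => ?_
    by_cases hxy : x = y
    · subst hxy
      rw [if_pos rfl, eq_comm, neg_eq_zero]
      refine Finset.sum_eq_zero fun σ _ => ?_
      rw [if_neg]
      rintro ⟨h0, h1⟩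
      rw [h0] at h1
      exact absurd h1 (by decide)
    · rw [if_neg hxy]
      exact pairMass_mul_klDiv_eq a hN x y hxy (hsym x y) (fun σ => hmove σ x y hxy)
        (fun σ => hmove σ y x (Ne.symm hxy))
  rw [Finset.sum_congr rfl fun x _ => hin x]
  simp only [Finset.sum_neg_distrib]
  congr 1
  symm
  calc ∑ σ : V → Fin 2, a σ ^ 2 * ∑ u, ∑ v,
          (if σ u = 0 ∧ σ v = 1 then Real.log (a (σ ∘ Equiv.swap u v) ^ 2 / a σ ^ 2) else 0)
      = ∑ σ : V → Fin 2, ∑ u, ∑ v, (if σ u = 0 ∧ σ v = 1 then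
          a σ ^ 2 * Real.log (a (σ ∘ Equiv.swap u v) ^ 2 / a σ ^ 2) else 0) := by
        refine Finset.sum_congr rfl fun σ _ => ?_
        rw [Finset.mul_sum]
        refine Finset.sum_congr rfl fun u _ => ?_
        rw [Finset.mul_sum]
        refine Finset.sum_congr rfl fun v _ => ?_
        split_ifs
        · rfl
        · rw [mul_zero]
    _ = ∑ u, ∑ σ : V → Fin 2, ∑ v, (if σ u = 0 ∧ σ v = 1 then
          a σ ^ 2 * Real.log (a (σ ∘ Equiv.swap u v) ^ 2 / a σ ^ 2) else 0) := Finset.sum_comm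
    _ = ∑ u, ∑ v, ∑ σ : V → Fin 2, (if σ u = 0 ∧ σ v = 1 then
          a σ ^ 2 * Real.log (a (σ ∘ Equiv.swap u v) ^ 2 / a σ ^ 2) else 0) :=
        Finset.sum_congr rfl fun u _ => Finset.sum_comm

/-- **Mean teleportation log-ratio** `T(ψ) = E_{ψ²} (1/(N(|V|−N))) Σ_{u occ, v emp} log(ψ(σ^{u→v})²/ψ(σ)²)`
(the move `σ^{u→v} = σ ∘ swap u v` for `u` occupied, `v` empty).  Always `≤ 0` for sector states (resampling
identity + Jensen); `−T(ψ)` is the pair-mass-averaged teleportation entropy. -/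
noncomputable def meanTeleLog (a : (V → Fin 2) → ℝ) (N : ℝ) : ℝ :=
  (∑ σ, a σ ^ 2 * ∑ u, ∑ v,
      if σ u = 0 ∧ σ v = 1 then Real.log (a (σ ∘ Equiv.swap u v) ^ 2 / a σ ^ 2) else 0)
    / (N * ((Fintype.card V : ℝ) - N))



omit [Fintype V] [DecidableEq V] in
/-- Indicator of «`u` occupied, `v` empty» as a product of occupation numbers. -/
theorem ite_occ_emp_eq (σ : V → Fin 2) (u v : V) (c : ℝ) :
    (if σ u = 0 ∧ σ v = 1 then c else 0) = occ σ u * (1 - occ σ v) * c := by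
  unfold occ
  have h01 : ∀ i : Fin 2, i = 0 ∨ i = 1 := by decide
  rcases h01 (σ u) with hu | hu <;> rcases h01 (σ v) with hv | hv <;> simp [hu, hv]

omit [DecidableEq V] in
/-- Particle and hole counts as sums of occupation numbers. -/
theorem sum_occ_eq_card (σ : V → Fin 2) :
    ∑ u, occ σ u = ((univ.filter fun z => σ z = 0).card : ℝ) := by
  unfold occ
  rw [Finset.sum_boole]

omit [DecidableEq V] in
/-- Hole count as a sum of `1 − n_v`. [folklore] -/
theorem sum_one_sub_occ_eq (σ : V → Fin 2) :
    ∑ v, (1 - occ σ v) = (Fintype.card V : ℝ) - ((univ.filter fun z => σ z = 0).card : ℝ) := by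
  rw [Finset.sum_sub_distrib, ← sum_occ_eq_card σ]
  simp

/-- **RESAMPLING IDENTITY (general):** `Σ_σ Σ_{u occ, v emp} ψ(σ^{u→v})² = N(|V|−N) · Σ_σ ψ(σ)²` on an
`N`-sector — double counting of (configuration, move) pairs; no structure of `ψ` is used. -/
theorem sum_moves_sq_eq (a : (V → Fin 2) → ℝ) (N : ℝ)
    (hsect : ∀ σ, a σ ≠ 0 → ((univ.filter fun z => σ z = 0).card : ℝ) = N) :
    ∑ σ : V → Fin 2, ∑ u, ∑ v, occ σ u * (1 - occ σ v) * a (σ ∘ Equiv.swap u v) ^ 2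
      = N * ((Fintype.card V : ℝ) - N) * ∑ σ : V → Fin 2, a σ ^ 2 := by
  calc ∑ σ : V → Fin 2, ∑ u, ∑ v, occ σ u * (1 - occ σ v) * a (σ ∘ Equiv.swap u v) ^ 2
      = ∑ u, ∑ v, ∑ σ : V → Fin 2, occ σ u * (1 - occ σ v) * a (σ ∘ Equiv.swap u v) ^ 2 := by
        rw [Finset.sum_comm]
        exact Finset.sum_congr rfl fun u _ => Finset.sum_comm
    _ = ∑ u, ∑ v, ∑ σ : V → Fin 2, (1 - occ σ u) * occ σ v * a σ ^ 2 :=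
        Finset.sum_congr rfl fun u _ => Finset.sum_congr rfl fun v _ =>
          sum_swap_move (fun σ => a σ ^ 2) u v
    _ = ∑ σ : V → Fin 2, ∑ u, ∑ v, (1 - occ σ u) * occ σ v * a σ ^ 2 := by
        have h1' : ∀ u, ∑ v, ∑ σ : V → Fin 2, (1 - occ σ u) * occ σ v * a σ ^ 2
            = ∑ σ : V → Fin 2, ∑ v, (1 - occ σ u) * occ σ v * a σ ^ 2 := fun u => Finset.sum_comm
        rw [Finset.sum_congr rfl fun u _ => h1' u]
        exact Finset.sum_comm
    _ = ∑ σ : V → Fin 2, a σ ^ 2 * ((∑ u, (1 - occ σ u)) * ∑ v, occ σ v) := by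
        refine Finset.sum_congr rfl fun σ _ => ?_
        rw [Finset.sum_mul_sum, Finset.mul_sum]
        refine Finset.sum_congr rfl fun u _ => ?_
        rw [Finset.mul_sum]
        exact Finset.sum_congr rfl fun v _ => by ring
    _ = ∑ σ : V → Fin 2, a σ ^ 2 * (N * ((Fintype.card V : ℝ) - N)) := by
        refine Finset.sum_congr rfl fun σ _ => ?_
        rcases eq_or_ne (a σ) 0 with h0 | hne
        · rw [h0]; ring
        · rw [sum_one_sub_occ_eq, sum_occ_eq_card, hsect σ hne]; ring
    _ = N * ((Fintype.card V : ℝ) - N) * ∑ σ : V → Fin 2, a σ ^ 2 := by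
        rw [Finset.mul_sum]; exact Finset.sum_congr rfl fun σ _ => by ring

end TeleTransfer

end Summit.HubbardSuperconductivity.HubbardSuperconductivity.Theorems.AnisotropyChord.InsertionEntropy
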